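import Literature.Computability.Complexity.CodeFPListKit
import Literature.Computability.Complexity.CodeFPBudgets
import HarnessLib

/-!
# Typed polynomial time on codes: lexicographic comparison and insertion sort with a context

Toolkit above `CodeFP.lean` / `CodeFPListKit.lean` / `CodeFPBudgets.lean` for programs that SORT
and take MINIMA with respect to keys living in lexicographic orders (the canoniser machine of
`GraphCanonizationProgram*.lean` compares codes of ordered graphs):

* `CodeFP.lexDecide lt eq l₁ l₂` — the lexicographic comparison of two lists from element tests,
  as ONE PASS over `zip l₁ l₂` with a three-valued state followed by a length comparison;
  `lexDecide_eq` — it decides `l₁ < l₂` (`List.lt`) when `lt`, `eq` decide `<`, `=` on a linear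
  order; **`CodeFP.lexLt`** — it is typed polynomial time from typed element tests (with a context);
* **`CodeFP.insertionSortCtx`** — `List.insertionSort` for a relation computed on codes with a
  context (one `orderedInsert` pass per item: the split fold of
  `Literature/Probability/RandomGraphs/PlantedCliqueProgramFP.lean`, made generic);
* `CodeFP.minBy` — the lesser of two items under a computed `≤`.

## References

* S. Arora, B. Barak, *Computational Complexity: A Modern Approach*, CUP 2009, §1.3 (closure of
  polynomial time under composition and polynomially bounded loops). [AroraBarakCC2009]
-/

namespace Literature.Computability.Complexity

open _root_.Computability Polynomial

namespace CodeFP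

variable {α σ : Type} {eα : α → List Bool} {eσ : σ → List Bool}

/-! ### Lexicographic comparison in one pass -/

/-- The state update of the lexicographic scan: `0` undecided, `1` smaller, `2` larger. [folklore] -/
def lexStep (lt eq : α → α → Bool) (s : ℕ) (p : α × α) : ℕ :=
  if s = 0 then (if lt p.1 p.2 then 1 else if eq p.1 p.2 then 0 else 2) else s

/-- **Lexicographic comparison** of `l₁`, `l₂` from element tests: scan `zip l₁ l₂`; the first
unequal pair decides, otherwise the shorter list is smaller. [folklore] -/
def lexDecide (lt eq : α → α → Bool) (l₁ l₂ : List α) : Bool :=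
  let s := (l₁.zip l₂).foldl (lexStep lt eq) 0
  decide (s = 1) || (decide (s = 0) && decide (l₁.length < l₂.length))

/-- A decided state is absorbing. [folklore] -/
theorem foldl_lexStep_of_ne_zero (lt eq : α → α → Bool) {s : ℕ} (hs : s ≠ 0) : ∀ l : List (α × α), l.foldl (lexStep lt eq) s = s
  | [] => rfl
  | p :: l => by rw [List.foldl_cons, show lexStep lt eq s p = s from if_neg hs, foldl_lexStep_of_ne_zero lt eq hs l]

/-- The state stays in `{0, 1, 2}`. [folklore] -/
theorem foldl_lexStep_le (lt eq : α → α → Bool) : ∀ (l : List (α × α)) (s : ℕ), s ≤ 2 → l.foldl (lexStep lt eq) s ≤ 2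
  | [], s, hs => hs
  | p :: l, s, hs => by
    rw [List.foldl_cons]
    refine foldl_lexStep_le lt eq l _ ?_
    unfold lexStep; split_ifs <;> omega

/-- **`lexDecide` decides the lexicographic order** of lists over a linear order (iff form). [folklore] -/
theorem lexDecide_eq_true_iff [LinearOrder α] {lt eq : α → α → Bool} (hlt : ∀ a b, lt a b = decide (a < b)) (heq : ∀ a b, eq a b = decide (a = b)) :
    ∀ l₁ l₂ : List α, lexDecide lt eq l₁ l₂ = true ↔ l₁ < l₂
  | [], [] => by simp [lexDecide]
  | [], b :: l₂ => by simp [lexDecide]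
  | a :: l₁, [] => by simp [lexDecide]
  | a :: l₁, b :: l₂ => by
    have ih := lexDecide_eq_true_iff hlt heq l₁ l₂
    unfold lexDecide at ih ⊢
    simp only [List.zip_cons_cons, List.foldl_cons, List.length_cons, Bool.or_eq_true, Bool.and_eq_true, decide_eq_true_iff] at ih ⊢
    by_cases hab : a < b
    · have hstep : lexStep lt eq 0 (a, b) = 1 := by simp [lexStep, hlt, hab]
      have h1 := foldl_lexStep_of_ne_zero lt eq one_ne_zero (l₁.zip l₂)
      simp [hstep, h1, List.cons_lt_cons_iff, hab]
    · by_cases hab' : a = b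
      · subst hab'
        have hstep : lexStep lt eq 0 (a, a) = 0 := by simp [lexStep, hlt, heq]
        simp only [hstep, List.cons_lt_cons_iff, lt_irrefl, false_or, true_and, Nat.add_lt_add_iff_right]
        exact ih
      · have hstep : lexStep lt eq 0 (a, b) = 2 := by simp [lexStep, hlt, heq, hab, hab']
        have h2 := foldl_lexStep_of_ne_zero lt eq two_ne_zero (l₁.zip l₂)
        simp [hstep, h2, List.cons_lt_cons_iff, hab, hab']

/-- **`lexDecide` decides the lexicographic order** (decision form). [folklore] -/
theorem lexDecide_eq [LinearOrder α] {lt eq : α → α → Bool} (hlt : ∀ a b, lt a b = decide (a < b)) (heq : ∀ a b, eq a b = decide (a = b))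
    (l₁ l₂ : List α) : lexDecide lt eq l₁ l₂ = decide (l₁ < l₂) := by
  rw [Bool.eq_iff_iff, decide_eq_true_iff]
  exact lexDecide_eq_true_iff hlt heq l₁ l₂

/-- **Lexicographic comparison is typed polynomial time** from typed element tests (all with a
context `σ`). [cite: AroraBarakCC2009, §1.3] -/
theorem lexLt {lt eq : σ → α → α → Bool}
    (hlt : CodeFP (pairE eσ (pairE eα eα)) bitE (fun t => lt t.1 t.2.1 t.2.2))
    (heq : CodeFP (pairE eσ (pairE eα eα)) bitE (fun t => eq t.1 t.2.1 t.2.2)) :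
    CodeFP (pairE eσ (pairE (rawE eα) (rawE eα))) bitE (fun p => lexDecide (lt p.1) (eq p.1) p.2.1 p.2.2) := by
  let cE : σ × ((α × α) × ℕ) → List Bool := pairE eσ (pairE (pairE eα eα) natE)
  have hs : CodeFP cE natE (fun t => t.2.2) := (snd _ _).snd'
  have hp : CodeFP cE (pairE eα eα) (fun t => t.2.1) := (snd _ _).fst'
  have hz : CodeFP cE bitE (fun t => decide (t.2.2 = 0)) := natEq.comp (hs.pair (const _ 0))
  have hl : CodeFP cE bitE (fun t => lt t.1 t.2.1.1 t.2.1.2) := hlt.comp ((fst _ _).pair hp)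
  have he : CodeFP cE bitE (fun t => eq t.1 t.2.1.1 t.2.1.2) := heq.comp ((fst _ _).pair hp)
  have hstep : CodeFP cE natE (fun t => lexStep (lt t.1) (eq t.1) t.2.2 t.2.1) :=
    (hz.ite (hl.ite (const _ 1) (he.ite (const _ 0) (const _ 2))) hs).congr fun t => by
      simp only [lexStep, decide_eq_true_eq]
  have hfold := foldl (σ := σ) (α := α × α) (β := ℕ) (eσ := eσ) (eα := pairE eα eα) (eβ := natE)
    (step := fun s p acc => lexStep (lt s) (eq s) acc p) (init := fun _ => 0) hstep (const _ 0) (C 4) (fun s l₁ l₂ => by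
      rw [eval_C]
      have h2 := foldl_lexStep_le (lt s) (eq s) l₁ 0 (Nat.zero_le _)
      have : (natE (l₁.foldl (lexStep (lt s) (eq s)) 0)).length ≤ (natE 2).length := by
        rw [length_natE, length_natE]; exact Nat.size_le_size h2
      exact this.trans (by decide))
  -- assemble on `(s, (l₁, l₂))`
  let dE : σ × (List α × List α) → List Bool := pairE eσ (pairE (rawE eα) (rawE eα))
  have hzip : CodeFP dE (rawE (pairE eα eα)) (fun p => p.2.1.zip p.2.2) := (rawZip eα eα).comp (snd _ _)
  have hstate : CodeFP dE natE (fun p => (p.2.1.zip p.2.2).foldl (lexStep (lt p.1) (eq p.1)) 0) :=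
    hfold.comp ((fst _ _).pair hzip)
  have h1 : CodeFP dE bitE (fun p => decide ((p.2.1.zip p.2.2).foldl (lexStep (lt p.1) (eq p.1)) 0 = 1)) := natEq.comp (hstate.pair (const _ 1))
  have h0 : CodeFP dE bitE (fun p => decide ((p.2.1.zip p.2.2).foldl (lexStep (lt p.1) (eq p.1)) 0 = 0)) := natEq.comp (hstate.pair (const _ 0))
  have hlen : CodeFP dE bitE (fun p => decide (p.2.1.length < p.2.2.length)) :=
    natLt.comp (((natLength eα).comp (snd _ _).fst').pair ((natLength eα).comp (snd _ _).snd'))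
  exact (h1.or (h0.and hlen)).congr fun p => by simp only [lexDecide]

/-! ### Insertion sort with a context -/

section Sorting

variable (r : σ → α → α → Prop) [∀ s, DecidableRel (r s)]

/-- One step of the split of a sorted list at a new item `a`: state `(done, before, after)`. [folklore] -/
def splitStepC (s : σ) (a b : α) (st : Bool × (List α × List α)) : Bool × (List α × List α) :=
  if st.1 || decide (r s a b) then (true, (st.2.1, st.2.2 ++ [b])) else (false, (st.2.1 ++ [b], st.2.2))

/-- Once done, the split step only appends to `after`. [folklore] -/
theorem foldl_splitStepC_true (s : σ) (a : α) :
    ∀ (l tw dw : List α), l.foldl (fun st b => splitStepC r s a b st) (true, (tw, dw)) = (true, (tw, dw ++ l))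
  | [], tw, dw => by simp
  | b :: l, tw, dw => by
    rw [List.foldl_cons, show splitStepC r s a b (true, (tw, dw)) = (true, (tw, dw ++ [b])) by simp [splitStepC],
      foldl_splitStepC_true s a l, List.append_assoc, List.singleton_append]

/-- **The split fold computes `orderedInsert`**: `before ++ a :: after`. [folklore] -/
theorem orderedInsert_eq_foldl_splitStepC (s : σ) (a : α) :
    ∀ (l tw : List α), tw ++ l.orderedInsert (r s) a =
      (l.foldl (fun st b => splitStepC r s a b st) (false, (tw, []))).2.1 ++ a :: (l.foldl (fun st b => splitStepC r s a b st) (false, (tw, []))).2.2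
  | [], tw => by simp
  | b :: l, tw => by
    rw [List.foldl_cons]
    by_cases h : r s a b
    · rw [show splitStepC r s a b (false, (tw, [])) = (true, (tw, [b])) by simp [splitStepC, h],
        foldl_splitStepC_true, List.orderedInsert, if_pos h, List.singleton_append]
    · rw [show splitStepC r s a b (false, (tw, [])) = (false, (tw ++ [b], [])) by simp [splitStepC, h],
        List.orderedInsert, if_neg h, ← orderedInsert_eq_foldl_splitStepC s a l (tw ++ [b]), List.append_assoc, List.singleton_append]

/-- The split fold only redistributes the items. [folklore] -/
theorem foldl_splitStepC_perm (s : σ) (a : α) :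
    ∀ (l : List α) (st : Bool × (List α × List α)),
      ((l.foldl (fun st b => splitStepC r s a b st) st).2.1 ++ (l.foldl (fun st b => splitStepC r s a b st) st).2.2).Perm (st.2.1 ++ st.2.2 ++ l)
  | [], st => by simp
  | b :: l, st => by
    rw [List.foldl_cons]
    refine (foldl_splitStepC_perm s a l (splitStepC r s a b st)).trans ?_
    have h : ((splitStepC r s a b st).2.1 ++ (splitStepC r s a b st).2.2).Perm (st.2.1 ++ st.2.2 ++ [b]) := by
      unfold splitStepC
      split_ifs
      · simp
      · simp only [List.append_assoc]; exact List.Perm.append_left _ List.perm_append_comm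
    calc ((splitStepC r s a b st).2.1 ++ (splitStepC r s a b st).2.2 ++ l).Perm (st.2.1 ++ st.2.2 ++ [b] ++ l) := h.append_right l
      _ = st.2.1 ++ st.2.2 ++ b :: l := by simp

variable {r}

/-- **`orderedInsert` is typed polynomial time** for a relation computed on codes with a context. [cite: AroraBarakCC2009, §1.3] -/
theorem orderedInsertCtx (hr : CodeFP (pairE eσ (pairE eα eα)) bitE (fun t => decide (r t.1 t.2.1 t.2.2))) :
    CodeFP (pairE (pairE eσ eα) (rawE eα)) (rawE eα) (fun p => p.2.orderedInsert (r p.1.1) p.1.2) := by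
  let κ : (σ × α) × (α × (Bool × (List α × List α))) → List Bool := pairE (pairE eσ eα) (pairE eα (pairE bitE (pairE (rawE eα) (rawE eα))))
  have es : CodeFP κ eσ (fun t => t.1.1) := (fst _ _).fst'
  have ea : CodeFP κ eα (fun t => t.1.2) := (fst _ _).snd'
  have eb : CodeFP κ eα (fun t => t.2.1) := (snd _ _).fst'
  have ed : CodeFP κ bitE (fun t => t.2.2.1) := (snd _ _).snd'.fst'
  have etw : CodeFP κ (rawE eα) (fun t => t.2.2.2.1) := (snd _ _).snd'.snd'.fst'
  have edw : CodeFP κ (rawE eα) (fun t => t.2.2.2.2) := (snd _ _).snd'.snd'.snd'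
  have hsb : CodeFP κ (rawE eα) (fun t => [t.2.1]) := (rawSingleton _).comp eb
  have hcond : CodeFP κ bitE (fun t => t.2.2.1 || decide (r t.1.1 t.1.2 t.2.1)) := ed.or (hr.comp (es.pair (ea.pair eb)))
  have hthen : CodeFP κ (pairE bitE (pairE (rawE eα) (rawE eα))) (fun t => (true, (t.2.2.2.1, t.2.2.2.2 ++ [t.2.1]))) :=
    (const _ true).pair (etw.pair ((rawAppend _).comp (edw.pair hsb)))
  have helse : CodeFP κ (pairE bitE (pairE (rawE eα) (rawE eα))) (fun t => (false, (t.2.2.2.1 ++ [t.2.1], t.2.2.2.2))) :=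
    (const _ false).pair (((rawAppend _).comp (etw.pair hsb)).pair edw)
  have hstep : CodeFP κ (pairE bitE (pairE (rawE eα) (rawE eα))) (fun t => splitStepC r t.1.1 t.1.2 t.2.1 t.2.2) :=
    (hcond.ite hthen helse).congr fun t => by simp only [splitStepC]
  have hinit : CodeFP (pairE eσ eα) (pairE bitE (pairE (rawE eα) (rawE eα))) (fun _ => ((false, ([], [])) : Bool × (List α × List α))) := const _ _
  have hfold := foldl (σ := σ × α) (α := α) (β := Bool × (List α × List α)) (eσ := pairE eσ eα) (eα := eα)
    (eβ := pairE bitE (pairE (rawE eα) (rawE eα))) (step := fun c b st => splitStepC r c.1 c.2 b st) (init := fun _ => (false, ([], []))) hstep hinit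
    (3 * X + 6) (fun c l₁ l₂ => by
      have hperm := foldl_splitStepC_perm r c.1 c.2 l₁ (false, ([], []))
      simp only [List.nil_append] at hperm
      set st := l₁.foldl (fun st b => splitStepC r c.1 c.2 b st) (false, ([], []))
      rw [eval_add, eval_mul, eval_X, eval_ofNat, eval_ofNat]
      simp only [pairE_apply, length_boolPair, bitE, List.length_singleton]
      have h1 : (rawE eα st.2.1).length + (rawE eα st.2.2).length ≤ (rawE eα (l₁ ++ l₂)).length := by
        rw [← List.length_append, ← rawE_append, length_rawE_eq_of_perm _ hperm]
        exact length_rawE_le_of_sublist _ (List.sublist_append_left l₁ l₂)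
      omega)
  have hres : CodeFP (pairE (pairE eσ eα) (rawE eα)) (rawE eα)
      (fun p => (p.2.foldl (fun st b => splitStepC r p.1.1 p.1.2 b st) (false, ([], []))).2.1 ++
        p.1.2 :: (p.2.foldl (fun st b => splitStepC r p.1.1 p.1.2 b st) (false, ([], []))).2.2) :=
    (rawAppend _).comp (hfold.snd'.fst'.pair ((rawCons _).comp ((fst _ _).snd'.pair hfold.snd'.snd')))
  refine hres.congr fun p => ?_
  have h := orderedInsert_eq_foldl_splitStepC r p.1.1 p.1.2 p.2 []
  rw [List.nil_append] at h
  exact h.symm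

/-- Insertion sort as a left fold over the reversed list. [folklore] -/
theorem insertionSort_eq_foldl_reverse' (R : α → α → Prop) [DecidableRel R] (l : List α) :
    l.insertionSort R = l.reverse.foldl (fun acc a => acc.orderedInsert R a) [] := by
  rw [List.foldl_reverse]; rfl

/-- **Insertion sort is typed polynomial time** for a relation computed on codes with a context. [cite: AroraBarakCC2009, §1.3] -/
theorem insertionSortCtx (hr : CodeFP (pairE eσ (pairE eα eα)) bitE (fun t => decide (r t.1 t.2.1 t.2.2))) :
    CodeFP (pairE eσ (rawE eα)) (rawE eα) (fun p => p.2.insertionSort (r p.1)) := by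
  have hstep : CodeFP (pairE eσ (pairE eα (rawE eα))) (rawE eα) (fun t => t.2.2.orderedInsert (r t.1) t.2.1) :=
    (orderedInsertCtx hr).comp (((fst _ _).pair (snd _ _).fst').pair (snd _ _).snd')
  have h := foldl (σ := σ) (α := α) (β := List α) (eσ := eσ) (eα := eα) (eβ := rawE eα)
    (step := fun s a acc => acc.orderedInsert (r s) a) (init := fun _ => []) hstep (const _ []) X (fun s l₁ l₂ => by
      rw [eval_X]
      have hperm : (l₁.foldl (fun acc a => acc.orderedInsert (r s) a) []).Perm l₁ := by
        rw [← List.reverse_reverse l₁, ← insertionSort_eq_foldl_reverse', List.reverse_reverse]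
        exact (List.perm_insertionSort _ _).trans (List.reverse_perm l₁)
      simp only [pairE_apply, length_boolPair]
      rw [length_rawE_eq_of_perm _ hperm]
      have := length_rawE_le_of_sublist eα (List.sublist_append_left l₁ l₂)
      omega)
  exact (h.comp ((fst _ _).pair ((rawReverse eα).comp (snd _ _)))).congr fun p => by
    simp only [insertionSort_eq_foldl_reverse']

end Sorting

/-! ### Minima -/

/-- **The lesser of two items** under a computed `≤` (the first on ties). [folklore] -/
theorem minBy {le : σ → α → α → Bool} (hle : CodeFP (pairE eσ (pairE eα eα)) bitE (fun t => le t.1 t.2.1 t.2.2)) :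
    CodeFP (pairE eσ (pairE eα eα)) eα (fun t => if le t.1 t.2.1 t.2.2 then t.2.1 else t.2.2) :=
  hle.ite (snd _ _).fst' (snd _ _).snd'

end CodeFP

end Literature.Computability.Complexity
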